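import Summits.Ventures.YMGap.Thresholds.SharpUniquenessJoin
import Summits.Ventures.YMGap.Thresholds.RegionBoundaryInfluence
import Summits.Ventures.YMGap.Thresholds.SharpClusteringRegion
import Summits.Ventures.YMGap.Thresholds.SharpClusteringRegionOffDiag
import Summits.Ventures.YMGap.Thresholds.SharpClusteringMassGap
import HarnessLib

/-!
# Venture YMGap — OBJECT U, the CAPSTONE: DLR uniqueness and the cell's track-(a) target type
# `ImprovedThreshold d N (1/(8d))` for `SU(N)` lattice Yang–Mills, HYPOTHESIS-FREE, every `N ≥ 2`, `d ≥ 3`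

HONEST FRAMING: venture file (cell `pub-ymgap`, track (a), OBJECT U of PLAN R132/R132′/R136, seat p1). LATTICE
strong-coupling statements for `SU(N)` Wilson lattice Yang–Mills on `ℤ^d` at 't Hooft coupling `|β| < 1/(8d)`
(tree coupling `N β`; `d = 4`: `|β| < 1/32`, i.e. `β_W = N²β < N²/32` — `SU(2)`: `β_W < 1/8`, `SU(3)`: `β_W < 9/32`);
printed: Shen–Zhu–Zhu, CMP 400 (2023), Thm 1.2 / Cor. 1.4 at `|β| < 1/(16(d-1))` (`d = 4`: `1/48`). NOTHING about the
continuum, the continuum mass gap, confinement at weak coupling, or physical couplings. This file only COMPOSES; every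
ingredient is a kernel theorem of the tree:
* U1 (ds-2, `SharpClusteringRegionOffDiag`): `offDiagHessBound_regionPot` and the four `regionH` facts — the off-diagonal
  Hessian of the kernel potential `regionPot E η β` (p2, `RegionPoincare`) has finite range and row sums `≤ 6(d-1)N|β|`;
* U2 (lit-1, `SharpClusteringRegion`): `kernel_covariance_exp_decay` — exponential covariance decay of every DLR kernel
  `γ_E(· | η)` on smooth cylinder observables, uniformly in `E` and `η`, from the Bakry–Émery Hessian bound
  `regionWilsonHessianBound_four_d` (p2), by the static Witten-Laplacian / Helffer–Sjöstrand argument;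
* U3 (p2, `RegionBoundaryInfluence`): `kernel_boundary_influence_le` — exponential tilt: the kernel means of a smooth
  cylinder observable under two boundary conditions differ by `≤ C (Σδ) Σ_{b ∈ collar(E) \ E} e^{-κ dist(Λ, b)}`;
* U4 + JOIN (p1, `SharpUniquenessDLR`, `SharpUniquenessJoin`): vanishing boundary influence along cubes ⇒ unique DLR
  state (`sharpUniqueness_of_boundaryBound`), and the threshold compositions;
* the SZZ transfer fact `shenZhuZhu_massGap_transfer` (SZZ Cor. 4.11 with the Hessian constant as a parameter) is a
  THEOREM of the tree (lit-1 + ds-2, `SharpClustering.shenZhuZhu_massGap_transfer_holds`, static proof: torus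
  covariance decay + tight-limit transfer).
RESULTS (no hypothesis beyond `d`, `N` bounds): `kernel_covariance_exp_decay_free` ((T_E) with U1 plugged in),
`kernel_boundary_influence_free`, ★ `sharpUniqueness_free : SharpUniqueness d N` (`d ≥ 1`, `N ≥ 2`: exactly one DLR
state at every `|β| < 1/(8d)`), ★ `massGapBelow_sharp_free : MassGapBelow d N (1/(8d))` (`d, N ≥ 2`: uniqueness AND
SZZ exponential clustering of every DLR state), ★ `improvedThreshold_sharp_free : ImprovedThreshold d N (1/(8d))`
(`d ≥ 3`, `N ≥ 2`: the cell's track-(a) TARGET TYPE — `1/(16(d-1)) < 1/(8d)` and the mass gap below it), and the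
`d = 4` numerals `improvedThreshold_dim4_free : ImprovedThreshold 4 N (1/32)`, `massGapAt_dim4_free`.

References: H. Shen, R. Zhu, X. Zhu, CMP 400 (2023) 805–851 (Thm 1.2, Rem. 1.3, Lemma 4.1, Cor. 4.11); D. Bakry,
M. Émery (1985); B. Helffer, J. Sjöstrand, J. Stat. Phys. 74 (1994); H.-O. Georgii (2011) Remark 1.24, Thm 8.7;
cell bus 2026-08-22 15:23Z–16:45Z (R132, R132′, R136; referee F-177/F-180/F-183/F-184).
-/

noncomputable section

open scoped Matrix BigOperators Matrix.Norms.Frobenius ContDiff Topology NNReal ProbabilityTheory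
open MeasureTheory Filter Function Finset ProbabilityTheory
open Literature.Probability.LatticeModels
open Literature.MathematicalPhysics.QuantumLattice (fundamentalRep continuous_fundamentalRep LGConfig
  ymSpecification ymGibbsMeasures plaquettesTouching plaquetteEdges)
open Literature.MathematicalPhysics.QuantumFieldTheory hiding ZdEdge
open Summit.Ventures.YMGap.LatticeBakryEmery (Cfg PSU emb emb_apply LinkLipschitz regionPot kernel_boundary_influence_le)
open Summit.Ventures.YMGap.SharpClustering (regionH offDiagHessBound_regionPot regionH_nonneg regionH_symm sum_regionH_le
  supNorm_le_one_of_regionH_ne_zero kernel_covariance_exp_decay shenZhuZhu_massGap_transfer_holds)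
open Summit.Ventures.YMGap.HessianSharp (sharpThresholdSU SharpUniqueness regionWilsonHessianBound_four_d sharpConst_pos
  sharpThresholdSU_values)

namespace Summit.Ventures.YMGap

namespace SharpUniquenessJoin

variable {d N : ℕ}

/-- **(T_E) with U1 plugged in — kernel covariance decay, hypothesis-free**: for `N ≠ 0` and every 't Hooft coupling
`β` with `K = N/2 - 4dN|β| > 0` (i.e. `|β| < 1/(8d)`) there is a rate `κ > 0` such that for every finite region `E`,
every exterior configuration `η` and all smooth cylinder observables `u, v` on `E` with per-link Lipschitz data
`δu, δv ≥ 0` whose supports are `m`-separated (sup-norm of base points),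
`|Cov_{γ_E(·|η)}(u, v)| ≤ (2/K) e^{-κ m} (Σ δu) (Σ δv)`. (lit-1's `kernel_covariance_exp_decay` fed with p2's
`regionWilsonHessianBound_four_d` and ds-2's `offDiagHessBound_regionPot` + `regionH` facts.) -/
theorem kernel_covariance_exp_decay_free (hN : N ≠ 0) (β : ℝ) (hK : 0 < (N : ℝ) / 2 - N * |β| * (4 * d)) :
    ∃ κ : ℝ, 0 < κ ∧ ∀ (E : Finset (Literature.MathematicalPhysics.QuantumLattice.ZdEdge d))
      (η : LGConfig d (Matrix.specialUnitaryGroup (Fin N) ℂ))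
      (u v : Cfg ↥E N → ℝ), ContDiff ℝ ∞ u → ContDiff ℝ ∞ v →
      ∀ (δu δv : ↥E → ℝ), (∀ e, 0 ≤ δu e) → (∀ e, 0 ≤ δv e) → LinkLipschitz u δu → LinkLipschitz v δv →
      ∀ (m : ℕ), (∀ e e', δu e ≠ 0 → δv e' ≠ 0 → m ≤ Site.supNorm (e.1.1 - e'.1.1)) →
      |cov[matrixCylinder E u, matrixCylinder E v; ymSpecification (fundamentalRep (Fin N)) ((N : ℝ) * β) E η]| ≤
        2 / ((N : ℝ) / 2 - N * |β| * (4 * d)) * Real.exp (-κ * m) * (∑ e, δu e) * (∑ e, δv e) := by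
  obtain ⟨κ, hκ, h⟩ := kernel_covariance_exp_decay (regionWilsonHessianBound_four_d (d := d) (N := N)) hN β hK
  refine ⟨κ, hκ, fun E η u v hu hv δu δv hδu hδv hLu hLv m hsep => ?_⟩
  exact h E η (regionH N E β) (offDiagHessBound_regionPot E η β) (regionH_nonneg N E β) (regionH_symm N E β)
    (sum_regionH_le N E β) (fun _ _ => supNorm_le_one_of_regionH_ne_zero) u v hu hv δu δv hδu hδv hLu hLv m hsep

/-- **Boundary influence bound, hypothesis-free** (U3 fed with the above): for `N ≠ 0` and `K = N/2 - 4dN|β| > 0`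
there are `κ > 0`, `C ≥ 0` such that for all finite `Λ ⊆ E`, all boundary conditions `η, η'` and every smooth cylinder
observable `matrixCylinder Λ f` with per-link Lipschitz data `δ ≥ 0`,
`|γ_E(matrixCylinder Λ f | η) − γ_E(matrixCylinder Λ f | η')| ≤ C (Σδ) Σ_{b ∈ collar(E) \ E} e^{-κ·setDistEdges Λ {b}}`. -/
theorem kernel_boundary_influence_free (hN : N ≠ 0) {β : ℝ} (hK : 0 < (N : ℝ) / 2 - N * |β| * (4 * d)) :
    ∃ κ C : ℝ, 0 < κ ∧ 0 ≤ C ∧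
      ∀ (E Λ : Finset (Literature.MathematicalPhysics.QuantumLattice.ZdEdge d)), Λ ⊆ E →
      ∀ (η η' : LGConfig d (Matrix.specialUnitaryGroup (Fin N) ℂ)) (f : Cfg ↥Λ N → ℝ),
        ContDiff ℝ ∞ f →
      ∀ (δ : ↥Λ → ℝ), (∀ e, 0 ≤ δ e) → LinkLipschitz f δ →
        |∫ U, matrixCylinder Λ f U ∂(ymSpecification (fundamentalRep (Fin N)) ((N : ℝ) * β) E η) -
          ∫ U, matrixCylinder Λ f U ∂(ymSpecification (fundamentalRep (Fin N)) ((N : ℝ) * β) E η')| ≤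
        C * (∑ e, δ e) *
          ∑ b ∈ ((plaquettesTouching E).biUnion plaquetteEdges) \ E, Real.exp (-κ * setDistEdges Λ {b}) :=
  kernel_boundary_influence_le (le_of_lt (div_pos two_pos hK)) (kernel_covariance_exp_decay_free hN β hK)

/-- ★ **DLR UNIQUENESS AT THE SHARP WINDOW, HYPOTHESIS-FREE**: for `d ≥ 1`, `N ≥ 2` and every 't Hooft coupling
`|β| < 1/(8d)`, the `SU(N)` Wilson specification on `ℤ^d` at tree coupling `N β` has EXACTLY ONE infinite-volume DLR
state (`HessianSharp.SharpUniqueness d N`; printed SZZ window `1/(16(d-1))` by Langevin coupling — here statically, by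
U1–U4). -/
theorem sharpUniqueness_free (hd : 1 ≤ d) (hN : 2 ≤ N) : SharpUniqueness d N :=
  sharpUniqueness_of_boundaryBound fun _ hβ =>
    kernel_boundary_influence_free (by omega) (sharpConst_pos hd hN hβ)

/-- ★ **`MassGapBelow d N (1/(8d))`, HYPOTHESIS-FREE** (`d, N ≥ 2`): at every 't Hooft coupling `|β| < 1/(8d)` the DLR
state is unique AND every DLR state clusters exponentially in SZZ's form (`MassGapAt d N β`) — uniqueness from
`sharpUniqueness_free`, clustering from the tree theorem `shenZhuZhu_massGap_transfer_holds` (lit-1 + ds-2). -/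
theorem massGapBelow_sharp_free (hd : 2 ≤ d) (hN : 2 ≤ N) : MassGapBelow d N (sharpThresholdSU d) :=
  HessianSharp.massGapBelow_sharp_of_uniqueness (shenZhuZhu_massGap_transfer_holds d N)
    (sharpUniqueness_free (le_trans one_le_two hd) hN) hd hN

/-- ★★ **THE CELL'S TRACK-(a) TARGET TYPE, HYPOTHESIS-FREE**: for every `d ≥ 3` and `N ≥ 2`,
`ImprovedThreshold d N (1/(8d))` — the threshold `1/(8d)` is STRICTLY larger than Shen–Zhu–Zhu's printed
`1/(16(d-1))`, and for every 't Hooft coupling `|β| < 1/(8d)` the `SU(N)` Wilson lattice Yang–Mills measure on `ℤ^d`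
(tree coupling `N β`) has a unique DLR state with exponential clustering (`MassGapAt d N β`). All `N ≥ 2`, uniformly
(the constant `1/(8d)` does not depend on `N`). Lattice strong coupling only; no continuum statement. -/
theorem improvedThreshold_sharp_free (hd : 3 ≤ d) (hN : 2 ≤ N) : ImprovedThreshold d N (sharpThresholdSU d) :=
  HessianSharp.improvedThreshold_sharp_of_uniqueness (shenZhuZhu_massGap_transfer_holds d N)
    (sharpUniqueness_free (le_trans (by norm_num) hd) hN) hd hN

/-- ★ **Numbers of record, `d = 4`**: `ImprovedThreshold 4 N (1/32)` for every `N ≥ 2`, hypothesis-free (printed bar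
`1/48`; Wilson units `β_W = N²β`: `SU(2)` `β_W < 1/8` vs `1/12`, `SU(3)` `β_W < 9/32` vs `3/16`). -/
theorem improvedThreshold_dim4_free (hN : 2 ≤ N) : ImprovedThreshold 4 N (1 / 32) := by
  have h := improvedThreshold_sharp_free (d := 4) (by norm_num) hN
  rwa [sharpThresholdSU_values.1] at h

/-- The mass gap at one coupling, `d = 4`: `MassGapAt 4 N β` for every `N ≥ 2` and every 't Hooft `|β| < 1/32`. -/
theorem massGapAt_dim4_free (hN : 2 ≤ N) {β : ℝ} (hβ : |β| < 1 / 32) : MassGapAt 4 N β :=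
  (improvedThreshold_dim4_free hN).2 β hβ

/-- DLR uniqueness at one coupling, `d = 4`: for every `N ≥ 2` and `|β| < 1/32`, the `SU(N)` Wilson specification at
tree coupling `N β` has exactly one DLR state. -/
theorem hasUniqueGibbsMeasure_dim4_free (hN : 2 ≤ N) {β : ℝ} (hβ : |β| < 1 / 32) :
    HasUniqueGibbsMeasure (ymSpecification (d := 4) (fundamentalRep (Fin N)) ((N : ℝ) * β)) := by
  have h := sharpUniqueness_free (d := 4) (by norm_num) hN
  exact h β (by rwa [sharpThresholdSU_values.1])

end SharpUniquenessJoin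

end Summit.Ventures.YMGap
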